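/-
Copyright: the b2b-balaban T⁴-continuum CRUX team, row NE7b leaf lineage `t4-ne7b-formalise-leaf-06` (gen 150). Project licence.
-/
import Summits.QuantumFields.BalabanUV.T4Continuum.Spine.NE7b.AnalyticHessianLetter
import Summits.QuantumFields.BalabanUV.T4Continuum.Spine.NE7b.HessianLocality

/-!
# THE HESSIAN LETTER FROM ANALYTICITY, LOCALISED: a holomorphic term that depends only on the coordinates in `S` has
# `|D²(Re E)(x)[v,v]| ≤ (2M∕δ²)·Σ_{i ∈ S} v_i²` — the per-term letter of `…HessianLocality` — and the `ℓ²`-field versions of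
# `…AnalyticHessianLetter` on `EuclideanSpace ℝ ι` (row NE7b, node U5c; supplier of displayed letters, kernel lemmas)

Cell `pub-balaban`, sub-cell `t4`, spine estimate NE7b (`T4WeightBudget.RelWeightBound`; the cell's OWN estimate — NOT PRINTED in
[Bałaban 1983–89], NOT PROVED).  Crux-route work under `Spine/NE7b/` by a row leaf on the convexity road; NOTHING of Bałaban's is
named, valued or asserted; no `T4Continuum/Support` leaf typed; no `def`; zero `sorry`.  Imports: the sibling `…AnalyticHessianLetter`
(Cauchy's inequality on complex lines ⟹ `|D²(Re E)(p)[z,z]| ≤ (2M∕δ²)‖z‖²` through contractive charts) and the OWNER's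
`…HessianLocality` (the double count `sum_sum_mem_le_of_boundedOverlap`, BY NAME; it brings Mathlib's `PiL2`).

WHY.  `…HessianLocality.hessianOn_lower_of_boundedOverlap` (OWNER g108) turns PER-TERM Hessian smallness «in the coordinates the term
touches», `−c·Σ_{i ∈ S_p} v_i² ≤ D²P_p(x)[v,v]`, into the road's window letter `−(c·d)‖v‖² ≤ D²(Σ_p P_p)(x)[v,v]` with the OVERLAP
constant `d`; `…ConvexWindowSuppliers.firstOrderOn_quadratic_add_of_hessianOn` consumes that letter on `EuclideanSpace ℝ (Fin n)`.  Both
display the per-term letter and leave it to the instance.  Print's local terms are analytic functions of the few (complexified) bond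
variables on one plaquette ∕ cube with a sup bound on a polydisc — read BY SHAPE only ([B12] CMP 109 §1; Dimock I §4), nothing asserted.
THIS FILE supplies the per-term letter from that currency: a term `E` holomorphic with `‖E‖ ≤ M` on a sup-norm `δ`-polydisc
neighbourhood and depending only on the coordinates in `S` obeys `|D²(Re E)(x)[v,v]| ≤ (2M∕δ²)·Σ_{i ∈ S} v_i²` — because the slice
`s ↦ Re E(x + s v)` only sees `v` through `S`, and `(sup_{i ∈ S}|v_i|)² ≤ Σ_{i ∈ S} v_i²`.  It also records the `ℓ²`-field (`EuclideanSpace`)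
versions of the sibling's letters, the currency of the road's sockets: the complexification `ℓ² → ℓ^∞` is CONTRACTIVE, so the sibling's
contractive-chart theorems apply with the same constants.

WHAT IS PROVED ([folklore]):
* §1 `hessian_eq_of_slices_eq` — two `C²` functions whose slices through `x` along `v` and through `x′` along `v′` coincide as
  functions of the real parameter have `D²P(x)[v,v] = D²Q(x′)[v′,v′]` (both are the second derivative of that one slice;
  `…AnalyticHessianLetter.iteratedDeriv_two_lineSlice`).
* §2 LATTICE FIELDS, SUP NORM (`ι → ℝ ↪ ι → ℂ`): `sq_norm_indicator_le_sum` (`‖𝟙_S·v‖_∞² ≤ Σ_{i ∈ S} v_i²`),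
  **`abs_hessian_lattice_local_le`** (`E` depends only on the coordinates in `S` ⊢ `|D²(Re E∘↑)(x)[v,v]| ≤ (2M∕δ²)·Σ_{i ∈ S} v_i²`).
* §3 `ℓ²` FIELDS (`EuclideanSpace ℝ ι ↪ ι → ℂ`, contractive: `norm_ofReal_le_euclidean`): **`abs_hessian_euclidean_le`**
  (`≤ (2M∕δ²)‖v‖₂²`), `abs_hessian_euclidean_mixed_le` (`≤ (4M∕δ²)‖v‖₂‖w‖₂`), **`hessianOn_euclidean_twoSided`** (the `hH` shape of
  `…ConvexWindowSuppliers.firstOrderOn_quadratic_add_of_hessianOn`, `h = 2M∕δ²`, from `closedBall (↑x) δ ⊆ U` for `x ∈ K`),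
  **`abs_iteratedFDeriv_two_euclidean_local_le`** (the `hH` shape of `…HessianLocality.abs_hessian_le_of_boundedOverlap` ∕
  `hessianOn_lower_of_boundedOverlap`, `c = 2M∕δ²`: `|iteratedFDeriv ℝ 2 P x ![v, v]| ≤ (2M∕δ²)·Σ_{i ∈ S} v_i²`).
* §5 SUMS OF LOCAL TERMS WITH BOUNDED OVERLAP (`…HessianLocality.sum_sum_mem_le_of_boundedOverlap` BY NAME):
  **`abs_iteratedFDeriv_two_sum_euclidean_le`** (`|iteratedFDeriv ℝ 2 (y ↦ Σ_p Re E_p(↑y)) x ![v, v]| ≤ (2M∕δ²)·d·‖v‖₂²`) and the road's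
  window letter **`hessianOn_sum_euclidean_twoSided`** — `…ConvexWindowSuppliers.firstOrderOn_quadratic_add_of_hessianOn`'s `hH` with
  `h = (2M∕δ²)·d`, COMPUTED from print's currency `(M, δ)`, the locality `S_p` and the overlap `d` (each term `C²` AT the window by
  analyticity — no global `C²` asked); and the PRINT-SHAPED weighted form (non-common `M_p`, `∀ i, Σ_{p : i ∈ S_p} M_p ≤ K₀` ⊢
  `h = 2K₀∕δ²`): `sum_mul_sum_mem_le_of_weightedOverlap`, **`abs_iteratedFDeriv_two_sum_euclidean_le_weighted`**,
  `hessianOn_sum_euclidean_twoSided_weighted` (the refuter's ι-ne7bref-g83-1: `M_X = E₀e^{−κ d_j(X)}` summable through a bond).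
* §6 a toy (`ι = Fin 2`, `E z = (z 0)²`, `S = {0}`: the locality hypothesis is inhabited and the letter ignores `v 1`).

NOT HERE (honest): the GLOBAL `ContDiff ℝ 2 (Pp p)` that `…HessianLocality` displays (this file gives the letters AT the points whose
polydisc lies in `U` — §5 shows the window letter needs no more; a cutoff ∕ extension, if a consumer insists, is theirs); a common
`δ` for all terms (per-term radii: rescale); WHICH terms of print with WHICH `(M_p, δ, S_p, K₀)` and — the refuter's R-AHL-g83-1 (c) —
whether the terms are the RENORMALISED ones (a sup-norm letter on unsubtracted inherited terms is mass-insertion power counting; print's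
gauge invariance + `β` counter-terms do the subtraction) — (A3) ∕ (A1c) ∕ the (D1)–(D4) bracket,
NC-NE7b-α UNRULED; anything of Bałaban's.  BY-NAME EFFECT ON THE WALL: NONE.  NE7b NOT PRINTED ∕ NOT PROVED; spine PROVED 0∕9; rung
(B)+1 on a FINITE torus — NOT infinite volume, NOT the mass gap, NOT Clay.
HONEST DEPENDENCY: continuum YM on T⁴ ⇐ BetaPertH ∧ nine spine estimates (0/9 proved); BetaPertH ⇐ (D1) ∧ (D4) ∧ CAP+tail.
-/

set_option autoImplicit false

open Set Filter Metric Topology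
open Summit.QuantumFields.BalabanUV.T4Continuum.NE7b.AnalyticHessianLetter
open Summit.QuantumFields.BalabanUV.T4Continuum.NE7b.HessianLocality

namespace Summit.QuantumFields.BalabanUV.T4Continuum.NE7b.AnalyticHessianLetterLocal

/-! ## §1 Equal slices have equal second directional derivatives -/

section Slices

variable {V : Type*} [NormedAddCommGroup V] [NormedSpace ℝ V] {V' : Type*} [NormedAddCommGroup V'] [NormedSpace ℝ V']

/-- **EQUAL SLICES, EQUAL HESSIAN ENTRIES**: `P` of class `C²` on an open `O ∋ x`, `Q` of class `C²` on an open `O′ ∋ x′`, and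
`P(x + s v) = Q(x′ + s v′)` for every real `s` ⟹ `D²P(x)[v,v] = D²Q(x′)[v′,v′]`. [folklore] -/
theorem hessian_eq_of_slices_eq {P : V → ℝ} {O : Set V} (hO : IsOpen O) (hP : ContDiffOn ℝ 2 P O) {x : V} (hx : x ∈ O)
    {Q : V' → ℝ} {O' : Set V'} (hO' : IsOpen O') (hQ : ContDiffOn ℝ 2 Q O') {x' : V'} (hx' : x' ∈ O') {v : V} {v' : V'}
    (h : ∀ s : ℝ, P (x + s • v) = Q (x' + s • v')) :
    fderiv ℝ (fderiv ℝ P) x v v = fderiv ℝ (fderiv ℝ Q) x' v' v' := by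
  rw [← iteratedDeriv_two_lineSlice hO hP hx v, ← iteratedDeriv_two_lineSlice hO' hQ hx' v']
  congr 1
  funext s
  exact h s

end Slices

/-! ## §2 Lattice fields with sup norms: a term depending only on the coordinates in `S` -/

section Lattice

variable {ι : Type*} [Fintype ι] {E : (ι → ℂ) → ℂ} {U : Set (ι → ℂ)} {M : ℝ}

/-- `‖𝟙_S·v‖_∞² ≤ Σ_{i ∈ S} v_i²` for a real lattice field `v` and a finite set of coordinates `S`. [folklore] -/
theorem sq_norm_indicator_le_sum [DecidableEq ι] (S : Finset ι) (v : ι → ℝ) :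
    ‖(fun i => if i ∈ S then v i else 0)‖ ^ 2 ≤ ∑ i ∈ S, v i ^ 2 := by
  have hsum : 0 ≤ ∑ i ∈ S, v i ^ 2 := Finset.sum_nonneg fun i _ => sq_nonneg _
  have hle : ‖(fun i => if i ∈ S then v i else 0)‖ ≤ √(∑ i ∈ S, v i ^ 2) := by
    refine (pi_norm_le_iff_of_nonneg (Real.sqrt_nonneg _)).2 fun i => ?_
    by_cases hi : i ∈ S
    · rw [if_pos hi, Real.norm_eq_abs, ← Real.sqrt_sq_eq_abs]
      exact Real.sqrt_le_sqrt (Finset.single_le_sum (fun j _ => sq_nonneg (v j)) hi)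
    · rw [if_neg hi, norm_zero]
      exact Real.sqrt_nonneg _
  calc ‖(fun i => if i ∈ S then v i else 0)‖ ^ 2 ≤ (√(∑ i ∈ S, v i ^ 2)) ^ 2 := pow_le_pow_left₀ (norm_nonneg _) hle 2
    _ = ∑ i ∈ S, v i ^ 2 := Real.sq_sqrt hsum

/-- The real part of a function of class `C²` over `ℂ` on an open `U ⊆ ι → ℂ` is of class `C²` over `ℝ` along the real lattice
fields whose complexification lies in `U` (the sibling's `contDiffOn_re_comp` with the componentwise chart). [folklore] -/
theorem contDiffOn_re_ofReal_pi (hE : ContDiffOn ℂ 2 E U) :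
    ContDiffOn ℝ 2 (fun y : ι → ℝ => (E (fun i => (y i : ℂ))).re) ((fun y : ι → ℝ => fun i => (y i : ℂ)) ⁻¹' U) := by
  set J : (ι → ℝ) →L[ℝ] (ι → ℂ) := ContinuousLinearMap.pi fun i => Complex.ofRealCLM.comp (ContinuousLinearMap.proj i)
    with hJ
  have hJa : ∀ y : ι → ℝ, J y = fun i => (y i : ℂ) := fun y => by ext i; simp [hJ]
  have h := contDiffOn_re_comp J hE
  have e1 : (fun y => (E (J y)).re) = fun y : ι → ℝ => (E (fun i => (y i : ℂ))).re := by funext y; rw [hJa]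
  have e2 : (J ⁻¹' U) = (fun y : ι → ℝ => fun i => (y i : ℂ)) ⁻¹' U := by ext y; simp [hJa]
  rwa [e1, e2] at h

/-- **THE PER-TERM LETTER OF `…HessianLocality` FROM ANALYTICITY (sup-norm lattice currency).**  `E` of class `C²` over `ℂ` with
`‖E‖ ≤ M` on an open `U ⊆ ι → ℂ`, depending only on the coordinates in `S` (`hloc`), and the closed `δ`-polydisc about the real
field `x` inside `U` ⟹ `|D²(y ↦ Re E(↑y))(x)[v,v]| ≤ (2M∕δ²)·Σ_{i ∈ S} v_i²`. [folklore] -/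
theorem abs_hessian_lattice_local_le [DecidableEq ι] (hU : IsOpen U) (hE : ContDiffOn ℂ 2 E U) (hM : ∀ q ∈ U, ‖E q‖ ≤ M) (S : Finset ι)
    (hloc : ∀ z z' : ι → ℂ, (∀ i ∈ S, z i = z' i) → E z = E z') {x : ι → ℝ} {δ : ℝ} (hδ : 0 < δ)
    (hsub : closedBall (fun i => (x i : ℂ)) δ ⊆ U) (v : ι → ℝ) :
    |fderiv ℝ (fderiv ℝ (fun y : ι → ℝ => (E (fun i => (y i : ℂ))).re)) x v v| ≤ 2 * M / δ ^ 2 * ∑ i ∈ S, v i ^ 2 := by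
  set v' : ι → ℝ := fun i => if i ∈ S then v i else 0 with hv'
  have hO : IsOpen ((fun y : ι → ℝ => fun i => (y i : ℂ)) ⁻¹' U) := hU.preimage (by fun_prop)
  have hx : x ∈ (fun y : ι → ℝ => fun i => (y i : ℂ)) ⁻¹' U := hsub (mem_closedBall_self hδ.le)
  have hP := contDiffOn_re_ofReal_pi (ι := ι) hE
  have hsl : ∀ s : ℝ, (fun y : ι → ℝ => (E (fun i => (y i : ℂ))).re) (x + s • v) =
      (fun y : ι → ℝ => (E (fun i => (y i : ℂ))).re) (x + s • v') := by
    intro s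
    simp only
    congr 1
    refine hloc _ _ fun i hi => ?_
    simp [hv', hi]
  rw [hessian_eq_of_slices_eq hO hP hx hO hP hx hsl]
  have hM0 : 0 ≤ 2 * M / δ ^ 2 := by
    have : 0 ≤ M := (norm_nonneg _).trans (hM _ hx)
    positivity
  exact (abs_hessian_lattice_le hU hE hM hδ hsub v').trans (mul_le_mul_of_nonneg_left (sq_norm_indicator_le_sum S v) hM0)

end Lattice

/-! ## §3 `ℓ²` fields: `EuclideanSpace ℝ ι ↪ ι → ℂ` is contractive, so the sibling's letters hold in `‖·‖₂` with the same constants -/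

section Euclidean

variable {ι : Type*} [Fintype ι] {E : (ι → ℂ) → ℂ} {U : Set (ι → ℂ)} {M : ℝ}

/-- **THE COMPLEXIFICATION `ℓ² → ℓ^∞` IS CONTRACTIVE**: `‖(i ↦ (v i : ℂ))‖_∞ ≤ ‖v‖₂` on `EuclideanSpace ℝ ι`. [folklore] -/
theorem norm_ofReal_le_euclidean (v : EuclideanSpace ℝ ι) : ‖(fun i => (v i : ℂ))‖ ≤ ‖v‖ :=
  (pi_norm_le_iff_of_nonneg (norm_nonneg v)).2 fun i => by simpa using PiLp.norm_apply_le v i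

/-- The real part of `E ∈ C²(U)` (over `ℂ`) read on `ℓ²` fields is `C²` over `ℝ` on the (open) real preimage of `U`. [folklore] -/
theorem contDiffOn_re_ofReal_euclidean (hE : ContDiffOn ℂ 2 E U) :
    ContDiffOn ℝ 2 (fun y : EuclideanSpace ℝ ι => (E (fun i => (y i : ℂ))).re)
      ((fun y : EuclideanSpace ℝ ι => fun i => (y i : ℂ)) ⁻¹' U) := by
  set J : EuclideanSpace ℝ ι →L[ℝ] (ι → ℂ) :=
    ContinuousLinearMap.pi fun i => Complex.ofRealCLM.comp (EuclideanSpace.proj i) with hJ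
  have hJa : ∀ y : EuclideanSpace ℝ ι, J y = fun i => (y i : ℂ) := fun y => by ext i; simp [hJ]
  have h := contDiffOn_re_comp J hE
  have e1 : (fun y => (E (J y)).re) = fun y : EuclideanSpace ℝ ι => (E (fun i => (y i : ℂ))).re := by funext y; rw [hJa]
  have e2 : (J ⁻¹' U) = (fun y : EuclideanSpace ℝ ι => fun i => (y i : ℂ)) ⁻¹' U := by ext y; simp [hJa]
  rwa [e1, e2] at h

omit [Fintype ι] in
/-- The real preimage of an open `U ⊆ ι → ℂ` under the `ℓ²` complexification is open. [folklore] -/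
theorem isOpen_preimage_ofReal_euclidean (hU : IsOpen U) :
    IsOpen ((fun y : EuclideanSpace ℝ ι => fun i => (y i : ℂ)) ⁻¹' U) := by
  refine hU.preimage (continuous_pi fun i => Complex.continuous_ofReal.comp ?_)
  exact (EuclideanSpace.proj i).continuous

/-- **HESSIAN LETTER FOR `ℓ²` FIELDS, DIAGONAL**: `E ∈ C²(U)` over `ℂ`, `‖E‖ ≤ M` on `U`, the closed sup-norm `δ`-polydisc about
`↑x` inside `U` ⟹ `|D²(y ↦ Re E(↑y))(x)[v,v]| ≤ (2M∕δ²)‖v‖₂²` for `x v : EuclideanSpace ℝ ι`. [folklore] -/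
theorem abs_hessian_euclidean_le (hU : IsOpen U) (hE : ContDiffOn ℂ 2 E U) (hM : ∀ q ∈ U, ‖E q‖ ≤ M) {x : EuclideanSpace ℝ ι}
    {δ : ℝ} (hδ : 0 < δ) (hsub : closedBall (fun i => (x i : ℂ)) δ ⊆ U) (v : EuclideanSpace ℝ ι) :
    |fderiv ℝ (fderiv ℝ (fun y : EuclideanSpace ℝ ι => (E (fun i => (y i : ℂ))).re)) x v v| ≤ 2 * M / δ ^ 2 * ‖v‖ ^ 2 := by
  set J : EuclideanSpace ℝ ι →L[ℝ] (ι → ℂ) :=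
    ContinuousLinearMap.pi fun i => Complex.ofRealCLM.comp (EuclideanSpace.proj i) with hJ
  have hJa : ∀ y : EuclideanSpace ℝ ι, J y = fun i => (y i : ℂ) := fun y => by ext i; simp [hJ]
  have hJn : ∀ y : EuclideanSpace ℝ ι, ‖J y‖ ≤ ‖y‖ := fun y => by rw [hJa]; exact norm_ofReal_le_euclidean y
  have hP : (fun y : EuclideanSpace ℝ ι => (E (fun i => (y i : ℂ))).re) = fun y => (E (J y)).re := by funext y; rw [hJa]
  rw [hP]
  exact abs_hessian_chart_le J hJn hU hE hM hδ (by rwa [hJa]) v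

/-- **HESSIAN LETTER FOR `ℓ²` FIELDS, MIXED**: `|D²(y ↦ Re E(↑y))(x)[v,w]| ≤ (4M∕δ²)‖v‖₂‖w‖₂`. [folklore] -/
theorem abs_hessian_euclidean_mixed_le (hU : IsOpen U) (hE : ContDiffOn ℂ 2 E U) (hM : ∀ q ∈ U, ‖E q‖ ≤ M)
    {x : EuclideanSpace ℝ ι} {δ : ℝ} (hδ : 0 < δ) (hsub : closedBall (fun i => (x i : ℂ)) δ ⊆ U) (v w : EuclideanSpace ℝ ι) :
    |fderiv ℝ (fderiv ℝ (fun y : EuclideanSpace ℝ ι => (E (fun i => (y i : ℂ))).re)) x v w| ≤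
      4 * M / δ ^ 2 * ‖v‖ * ‖w‖ := by
  set J : EuclideanSpace ℝ ι →L[ℝ] (ι → ℂ) :=
    ContinuousLinearMap.pi fun i => Complex.ofRealCLM.comp (EuclideanSpace.proj i) with hJ
  have hJa : ∀ y : EuclideanSpace ℝ ι, J y = fun i => (y i : ℂ) := fun y => by ext i; simp [hJ]
  have hJn : ∀ y : EuclideanSpace ℝ ι, ‖J y‖ ≤ ‖y‖ := fun y => by rw [hJa]; exact norm_ofReal_le_euclidean y
  have hP : (fun y : EuclideanSpace ℝ ι => (E (fun i => (y i : ℂ))).re) = fun y => (E (J y)).re := by funext y; rw [hJa]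
  rw [hP]
  exact abs_hessian_chart_mixed_le J hJn hU hE hM hδ (by rwa [hJa]) v w

/-- **THE WINDOW LETTER OF `…ConvexWindowSuppliers.firstOrderOn_quadratic_add_of_hessianOn` FROM ANALYTICITY** (`ℓ²` currency,
`h = 2M∕δ²`): on a real window `K ⊆ EuclideanSpace ℝ ι` whose closed complex `δ`-polydiscs lie in `U`,
`∀ x ∈ K, ∀ v, −(2M∕δ²)‖v‖² ≤ iteratedFDeriv ℝ 2 (y ↦ Re E(↑y)) x ![v, v] ≤ (2M∕δ²)‖v‖²`. [folklore] -/
theorem hessianOn_euclidean_twoSided (hU : IsOpen U) (hE : ContDiffOn ℂ 2 E U) (hM : ∀ q ∈ U, ‖E q‖ ≤ M)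
    {K : Set (EuclideanSpace ℝ ι)} {δ : ℝ} (hδ : 0 < δ) (hK : ∀ x ∈ K, closedBall (fun i => (x i : ℂ)) δ ⊆ U) :
    ∀ x ∈ K, ∀ v : EuclideanSpace ℝ ι,
      -(2 * M / δ ^ 2) * ‖v‖ ^ 2 ≤ iteratedFDeriv ℝ 2 (fun y : EuclideanSpace ℝ ι => (E (fun i => (y i : ℂ))).re) x ![v, v] ∧
      iteratedFDeriv ℝ 2 (fun y : EuclideanSpace ℝ ι => (E (fun i => (y i : ℂ))).re) x ![v, v] ≤ 2 * M / δ ^ 2 * ‖v‖ ^ 2 := by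
  intro x hx v
  have h' : |iteratedFDeriv ℝ 2 (fun y : EuclideanSpace ℝ ι => (E (fun i => (y i : ℂ))).re) x ![v, v]| ≤
      2 * M / δ ^ 2 * ‖v‖ ^ 2 := by
    rw [iteratedFDeriv_two_apply]
    exact abs_hessian_euclidean_le hU hE hM hδ (hK x hx) v
  have h := abs_le.mp h'
  constructor <;> linarith [h.1, h.2]

/-- **THE PER-TERM LETTER OF `…HessianLocality` FROM ANALYTICITY** (`ℓ²` currency, `c = 2M∕δ²`): `E ∈ C²(U)` over `ℂ` with
`‖E‖ ≤ M` on `U`, depending only on the coordinates in `S`, and the closed `δ`-polydisc about `↑x` inside `U` ⟹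
`|iteratedFDeriv ℝ 2 (y ↦ Re E(↑y)) x ![v, v]| ≤ (2M∕δ²)·Σ_{i ∈ S} v_i²` — the hypothesis `hH` of
`…HessianLocality.abs_hessian_le_of_boundedOverlap` (and, by `abs_le`, of `hessianOn_lower_of_boundedOverlap`) for this term. [folklore] -/
theorem abs_iteratedFDeriv_two_euclidean_local_le [DecidableEq ι] (hU : IsOpen U) (hE : ContDiffOn ℂ 2 E U) (hM : ∀ q ∈ U, ‖E q‖ ≤ M)
    (S : Finset ι) (hloc : ∀ z z' : ι → ℂ, (∀ i ∈ S, z i = z' i) → E z = E z') {x : EuclideanSpace ℝ ι} {δ : ℝ} (hδ : 0 < δ)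
    (hsub : closedBall (fun i => (x i : ℂ)) δ ⊆ U) (v : EuclideanSpace ℝ ι) :
    |iteratedFDeriv ℝ 2 (fun y : EuclideanSpace ℝ ι => (E (fun i => (y i : ℂ))).re) x ![v, v]| ≤ 2 * M / δ ^ 2 * ∑ i ∈ S, v i ^ 2 := by
  -- the `ℓ²` slice through `x` along `v` is the sup-norm slice through `⇑x` along `⇑v`
  have hO₂ := isOpen_preimage_ofReal_euclidean (ι := ι) hU
  have hx₂ : x ∈ (fun y : EuclideanSpace ℝ ι => fun i => (y i : ℂ)) ⁻¹' U := hsub (mem_closedBall_self hδ.le)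
  have hP₂ := contDiffOn_re_ofReal_euclidean (ι := ι) hE
  have hO₁ : IsOpen ((fun y : ι → ℝ => fun i => (y i : ℂ)) ⁻¹' U) := hU.preimage (by fun_prop)
  have hx₁ : (fun i => x i) ∈ (fun y : ι → ℝ => fun i => (y i : ℂ)) ⁻¹' U := hsub (mem_closedBall_self hδ.le)
  have hP₁ := contDiffOn_re_ofReal_pi (ι := ι) hE
  have hsl : ∀ s : ℝ, (fun y : EuclideanSpace ℝ ι => (E (fun i => (y i : ℂ))).re) (x + s • v) =
      (fun y : ι → ℝ => (E (fun i => (y i : ℂ))).re) ((fun i => x i) + s • fun i => v i) := by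
    intro s
    simp only [PiLp.add_apply, PiLp.smul_apply, smul_eq_mul, Pi.add_apply, Pi.smul_apply]
  have habs : |fderiv ℝ (fderiv ℝ (fun y : EuclideanSpace ℝ ι => (E (fun i => (y i : ℂ))).re)) x v v| ≤
      2 * M / δ ^ 2 * ∑ i ∈ S, v i ^ 2 := by
    rw [hessian_eq_of_slices_eq hO₂ hP₂ hx₂ hO₁ hP₁ hx₁ hsl]
    exact abs_hessian_lattice_local_le hU hE hM S hloc hδ hsub fun i => v i
  rw [iteratedFDeriv_two_apply]
  exact habs

end Euclidean

/-! ## §5 Sums of local analytic terms with bounded overlap: the road's window letter with `h = (2M∕δ²)·d`, in print's currency -/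

section Sum

variable {ι : Type*} [Fintype ι] [DecidableEq ι] {𝔓 : Type*} [Fintype 𝔓] {Ep : 𝔓 → (ι → ℂ) → ℂ} {U : Set (ι → ℂ)} {M : ℝ}

/-- **THE WINDOW LETTER OF A SUM OF LOCAL ANALYTIC TERMS, COMPUTED FROM `(M, δ, d)`**: terms `E_p` of class `C²` over `ℂ` with
`‖E_p‖ ≤ M` (`M ≥ 0`) on a common open `U ⊆ ι → ℂ`, each depending only on the coordinates in `S_p`, every coordinate in at most `d` of the
`S_p` (the OWNER's `…HessianLocality.sum_sum_mem_le_of_boundedOverlap` BY NAME), and the closed `δ`-polydisc about `↑x` inside `U` ⟹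
`|iteratedFDeriv ℝ 2 (y ↦ Σ_p Re E_p(↑y)) x ![v, v]| ≤ (2M∕δ²)·d·‖v‖₂²`. [folklore] -/
theorem abs_iteratedFDeriv_two_sum_euclidean_le (hU : IsOpen U) (hE : ∀ p, ContDiffOn ℂ 2 (Ep p) U) (hM0 : 0 ≤ M)
    (hM : ∀ p, ∀ q ∈ U, ‖Ep p q‖ ≤ M) (S : 𝔓 → Finset ι) (hloc : ∀ p, ∀ z z' : ι → ℂ, (∀ i ∈ S p, z i = z' i) → Ep p z = Ep p z')
    {d : ℕ} (hd : ∀ i, (Finset.univ.filter fun p => i ∈ S p).card ≤ d) {x : EuclideanSpace ℝ ι} {δ : ℝ} (hδ : 0 < δ)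
    (hsub : closedBall (fun i => (x i : ℂ)) δ ⊆ U) (v : EuclideanSpace ℝ ι) :
    |iteratedFDeriv ℝ 2 (fun y : EuclideanSpace ℝ ι => ∑ p, (Ep p (fun i => (y i : ℂ))).re) x ![v, v]| ≤
      2 * M / δ ^ 2 * d * ‖v‖ ^ 2 := by
  have hx : x ∈ (fun y : EuclideanSpace ℝ ι => fun i => (y i : ℂ)) ⁻¹' U := hsub (mem_closedBall_self hδ.le)
  have hAt : ∀ p ∈ (Finset.univ : Finset 𝔓),
      ContDiffAt ℝ 2 (fun y : EuclideanSpace ℝ ι => (Ep p (fun i => (y i : ℂ))).re) x := fun p _ =>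
    (contDiffOn_re_ofReal_euclidean (hE p)).contDiffAt ((isOpen_preimage_ofReal_euclidean hU).mem_nhds hx)
  rw [iteratedFDeriv_fun_sum_apply hAt, _root_.sum_apply]
  refine (Finset.abs_sum_le_sum_abs _ _).trans ?_
  refine (Finset.sum_le_sum fun p _ =>
    abs_iteratedFDeriv_two_euclidean_local_le hU (hE p) (hM p) (S p) (hloc p) hδ hsub v).trans ?_
  rw [← Finset.mul_sum, mul_assoc (2 * M / δ ^ 2), EuclideanSpace.real_norm_sq_eq]
  exact mul_le_mul_of_nonneg_left (sum_sum_mem_le_of_boundedOverlap S hd fun i => sq_nonneg _) (by positivity)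

/-- **THE ROAD's WINDOW LETTER FOR A SUM OF LOCAL ANALYTIC TERMS** (`…ConvexWindowSuppliers.firstOrderOn_quadratic_add_of_hessianOn`'s
`hH` with `h = (2M∕δ²)·d`; `…HessianLocality`'s composition with its per-term letter SUPPLIED): on a real window `K` whose closed
`δ`-polydiscs lie in `U`, `∀ x ∈ K, ∀ v, −((2M∕δ²)·d)‖v‖² ≤ iteratedFDeriv ℝ 2 (y ↦ Σ_p Re E_p(↑y)) x ![v, v] ≤ ((2M∕δ²)·d)‖v‖²`. [folklore] -/
theorem hessianOn_sum_euclidean_twoSided (hU : IsOpen U) (hE : ∀ p, ContDiffOn ℂ 2 (Ep p) U) (hM0 : 0 ≤ M)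
    (hM : ∀ p, ∀ q ∈ U, ‖Ep p q‖ ≤ M) (S : 𝔓 → Finset ι) (hloc : ∀ p, ∀ z z' : ι → ℂ, (∀ i ∈ S p, z i = z' i) → Ep p z = Ep p z') {d : ℕ}
    (hd : ∀ i, (Finset.univ.filter fun p => i ∈ S p).card ≤ d) {K : Set (EuclideanSpace ℝ ι)} {δ : ℝ} (hδ : 0 < δ)
    (hK : ∀ x ∈ K, closedBall (fun i => (x i : ℂ)) δ ⊆ U) :
    ∀ x ∈ K, ∀ v : EuclideanSpace ℝ ι,
      -(2 * M / δ ^ 2 * d) * ‖v‖ ^ 2 ≤ iteratedFDeriv ℝ 2 (fun y : EuclideanSpace ℝ ι => ∑ p, (Ep p (fun i => (y i : ℂ))).re) x ![v, v] ∧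
      iteratedFDeriv ℝ 2 (fun y : EuclideanSpace ℝ ι => ∑ p, (Ep p (fun i => (y i : ℂ))).re) x ![v, v] ≤
        2 * M / δ ^ 2 * d * ‖v‖ ^ 2 := by
  intro x hx v
  have h := abs_le.mp (abs_iteratedFDeriv_two_sum_euclidean_le hU hE hM0 hM S hloc hd hδ (hK x hx) v)
  constructor <;> linarith [h.1, h.2]

/-- **WEIGHTED DOUBLE COUNT**: `Σ_p M_p·Σ_{i ∈ S_p} a_i ≤ K₀·Σ_i a_i` when `a ≥ 0` and every coordinate's incident weights sum to at most
`K₀` (`∀ i, Σ_{p : i ∈ S_p} M_p ≤ K₀`) — the print-shaped overlap letter (non-common `M_p`, the refuter's ι-ne7bref-g83-1). [folklore] -/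
theorem sum_mul_sum_mem_le_of_weightedOverlap (S : 𝔓 → Finset ι) (Mw : 𝔓 → ℝ) {K₀ : ℝ}
    (hK₀ : ∀ i, ∑ p ∈ Finset.univ.filter (fun p => i ∈ S p), Mw p ≤ K₀) {a : ι → ℝ} (ha : ∀ i, 0 ≤ a i) :
    ∑ p, Mw p * ∑ i ∈ S p, a i ≤ K₀ * ∑ i, a i := by
  have e : ∀ p, Mw p * ∑ i ∈ S p, a i = ∑ i, (if i ∈ S p then Mw p else 0) * a i := fun p => by
    simp_rw [ite_mul, zero_mul]
    rw [Finset.mul_sum, ← Finset.sum_filter]; congr 1; ext i; simp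
  simp_rw [e]
  rw [Finset.sum_comm, Finset.mul_sum]
  refine Finset.sum_le_sum fun i _ => ?_
  rw [← Finset.sum_mul]
  refine mul_le_mul_of_nonneg_right ?_ (ha i)
  rw [Finset.sum_ite, Finset.sum_const_zero, add_zero]
  exact hK₀ i

/-- **THE WINDOW LETTER OF A SUM OF LOCAL ANALYTIC TERMS WITH NON-COMMON BOUNDS `M_p` AND A WEIGHTED OVERLAP** (print's shape: `M_X =
E₀e^{−κ d_j(X)}` per localization domain, summable over the domains through a bond — the refuter's ι-ne7bref-g83-1; the OWNER's
`…HessianLocality.hessian_lower_of_weightedOverlap` is the displayed-letter twin): `E_p ∈ C²(U)`, `‖E_p‖ ≤ M_p` on `U`, `E_p` depending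
only on `S_p`, `∀ i, Σ_{p : i ∈ S_p} M_p ≤ K₀`, `closedBall (↑x) δ ⊆ U` ⊢ `|iteratedFDeriv ℝ 2 (y ↦ Σ_p Re E_p(↑y)) x ![v, v]| ≤ (2K₀∕δ²)‖v‖₂²`. [folklore] -/
theorem abs_iteratedFDeriv_two_sum_euclidean_le_weighted (hU : IsOpen U) (hE : ∀ p, ContDiffOn ℂ 2 (Ep p) U) (Mw : 𝔓 → ℝ)
    (hM : ∀ p, ∀ q ∈ U, ‖Ep p q‖ ≤ Mw p) (S : 𝔓 → Finset ι) (hloc : ∀ p, ∀ z z' : ι → ℂ, (∀ i ∈ S p, z i = z' i) → Ep p z = Ep p z')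
    {K₀ : ℝ} (hK₀ : ∀ i, ∑ p ∈ Finset.univ.filter (fun p => i ∈ S p), Mw p ≤ K₀) {x : EuclideanSpace ℝ ι} {δ : ℝ} (hδ : 0 < δ)
    (hsub : closedBall (fun i => (x i : ℂ)) δ ⊆ U) (v : EuclideanSpace ℝ ι) :
    |iteratedFDeriv ℝ 2 (fun y : EuclideanSpace ℝ ι => ∑ p, (Ep p (fun i => (y i : ℂ))).re) x ![v, v]| ≤ 2 * K₀ / δ ^ 2 * ‖v‖ ^ 2 := by
  have hx : x ∈ (fun y : EuclideanSpace ℝ ι => fun i => (y i : ℂ)) ⁻¹' U := hsub (mem_closedBall_self hδ.le)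
  have hAt : ∀ p ∈ (Finset.univ : Finset 𝔓),
      ContDiffAt ℝ 2 (fun y : EuclideanSpace ℝ ι => (Ep p (fun i => (y i : ℂ))).re) x := fun p _ =>
    (contDiffOn_re_ofReal_euclidean (hE p)).contDiffAt ((isOpen_preimage_ofReal_euclidean hU).mem_nhds hx)
  rw [iteratedFDeriv_fun_sum_apply hAt, _root_.sum_apply]
  refine (Finset.abs_sum_le_sum_abs _ _).trans ?_
  refine (Finset.sum_le_sum fun p _ =>
    abs_iteratedFDeriv_two_euclidean_local_le hU (hE p) (hM p) (S p) (hloc p) hδ hsub v).trans ?_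
  have e : ∀ p, 2 * Mw p / δ ^ 2 * ∑ i ∈ S p, v i ^ 2 = 2 / δ ^ 2 * (Mw p * ∑ i ∈ S p, v i ^ 2) := fun p => by ring
  simp_rw [e]
  rw [← Finset.mul_sum, EuclideanSpace.real_norm_sq_eq,
    show 2 * K₀ / δ ^ 2 * ∑ i, v i ^ 2 = 2 / δ ^ 2 * (K₀ * ∑ i, v i ^ 2) by ring]
  exact mul_le_mul_of_nonneg_left (sum_mul_sum_mem_le_of_weightedOverlap S Mw hK₀ fun i => sq_nonneg _) (by positivity)

/-- **THE ROAD's WINDOW LETTER, WEIGHTED OVERLAP** (`h = 2K₀∕δ²`): on a real window `K` whose closed `δ`-polydiscs lie in `U`,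
`∀ x ∈ K, ∀ v, −(2K₀∕δ²)‖v‖² ≤ iteratedFDeriv ℝ 2 (y ↦ Σ_p Re E_p(↑y)) x ![v, v] ≤ (2K₀∕δ²)‖v‖²`. [folklore] -/
theorem hessianOn_sum_euclidean_twoSided_weighted (hU : IsOpen U) (hE : ∀ p, ContDiffOn ℂ 2 (Ep p) U) (Mw : 𝔓 → ℝ)
    (hM : ∀ p, ∀ q ∈ U, ‖Ep p q‖ ≤ Mw p) (S : 𝔓 → Finset ι) (hloc : ∀ p, ∀ z z' : ι → ℂ, (∀ i ∈ S p, z i = z' i) → Ep p z = Ep p z')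
    {K₀ : ℝ} (hK₀ : ∀ i, ∑ p ∈ Finset.univ.filter (fun p => i ∈ S p), Mw p ≤ K₀) {K : Set (EuclideanSpace ℝ ι)} {δ : ℝ}
    (hδ : 0 < δ) (hK : ∀ x ∈ K, closedBall (fun i => (x i : ℂ)) δ ⊆ U) :
    ∀ x ∈ K, ∀ v : EuclideanSpace ℝ ι,
      -(2 * K₀ / δ ^ 2) * ‖v‖ ^ 2 ≤ iteratedFDeriv ℝ 2 (fun y : EuclideanSpace ℝ ι => ∑ p, (Ep p (fun i => (y i : ℂ))).re) x ![v, v] ∧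
      iteratedFDeriv ℝ 2 (fun y : EuclideanSpace ℝ ι => ∑ p, (Ep p (fun i => (y i : ℂ))).re) x ![v, v] ≤
        2 * K₀ / δ ^ 2 * ‖v‖ ^ 2 := by
  intro x hx v
  have h := abs_le.mp (abs_iteratedFDeriv_two_sum_euclidean_le_weighted hU hE Mw hM S hloc hK₀ hδ (hK x hx) v)
  constructor <;> linarith [h.1, h.2]

end Sum

/-! ## §6 Toy: the locality hypothesis is inhabited (`ι = Fin 2`, `E z = (z 0)²`, `S = {0}`) -/

/-- Toy instance of `abs_hessian_lattice_local_le`: `E z = (z 0)²` on the sup-norm ball of radius `2` about `0` in `Fin 2 → ℂ`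
depends only on coordinate `0`, `‖E‖ ≤ 4` there, `δ = 1`: the letter reads `|D²(Re E∘↑)(0)[v,v]| ≤ 8·(v 0)²`, blind to `v 1`. [folklore] -/
example (v : Fin 2 → ℝ) :
    |fderiv ℝ (fderiv ℝ (fun y : Fin 2 → ℝ => ((fun z : Fin 2 → ℂ => z 0 ^ 2) (fun i => (y i : ℂ))).re)) 0 v v| ≤
      2 * 4 / 1 ^ 2 * ∑ i ∈ ({0} : Finset (Fin 2)), v i ^ 2 := by
  have hsub : closedBall (fun i : Fin 2 => ((0 : Fin 2 → ℝ) i : ℂ)) 1 ⊆ ball (0 : Fin 2 → ℂ) 2 := by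
    have h0 : (fun i : Fin 2 => ((0 : Fin 2 → ℝ) i : ℂ)) = 0 := by funext i; simp
    rw [h0]
    exact closedBall_subset_ball (by norm_num)
  refine abs_hessian_lattice_local_le (E := fun z : Fin 2 → ℂ => z 0 ^ 2) (U := ball (0 : Fin 2 → ℂ) 2) (M := 4) isOpen_ball
    (((ContinuousLinearMap.proj (R := ℂ) (φ := fun _ : Fin 2 => ℂ) 0).contDiff.pow 2).contDiffOn) ?_ {0} ?_ one_pos hsub v
  · intro q hq
    have hq0 : ‖q 0‖ ≤ ‖q‖ := norm_le_pi_norm q 0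
    have hq' : ‖q‖ < 2 := by simpa using hq
    rw [norm_pow]
    nlinarith [norm_nonneg (q 0)]
  · intro z z' h
    simp [h 0 (Finset.mem_singleton_self 0)]

end Summit.QuantumFields.BalabanUV.T4Continuum.NE7b.AnalyticHessianLetterLocal
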